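import Summits.BirchSwinnertonDyer.BirchSwinnertonDyer.Theorems.CMKolyvaginAtInertTwoCMPrimitiveSupplyAtInertTwoOfKolyvaginConjecture
import HarnessLib

/-! Scratch (bsd-line-cmk2-p1 g22): TURNKEY for the pen's deferred edit «Σ ≤ 1 restriction of the Kolyvagin-conjecture family
24648 / 28176 / 28177» (route file rev 19/20, NOT DECOMPOSED YET).  Kernel check that restricting the three decls to Heegner fields of
ONE-BIT genus defect (the clause `Σ ≤ 1 →` inserted right after the Heegner hypothesis, same position and text as in
`CMKolyvaginExactAtInertTwoOneBitRestated`) keeps the route closable: the glue R0 → R1 → KC is unchanged in shape, and the supply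
derivation `CMPrimitiveSupplyAtInertTwoOneBitOfFacts` (28664, closed by p762930) re-proves VERBATIM with the one-bit KC, because the
HL′ field it feeds to KC has `Σ ≤ 1`.  Decl texts below = the current route decls with that single insertion (generated mechanically
from the rev-20 file).  Nothing is filed here; the edit is the pen's (D-0059).  BSD is not proved by any of this. -/

-- single-conjunct summit: `Summit.BirchSwinnertonDyer.BirchSwinnertonDyer.…` repeats the name by design
set_option linter.dupNamespace false
set_option autoImplicit false

noncomputable section

open scoped Classical

namespace Scratch.CMKolyvaginConjectureOneBit

open WeierstrassCurve NumberField
open Literature.NumberTheory.EllipticCurves Literature.NumberTheory.EllipticCurves.ModularForms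
open Literature.NumberTheory.EllipticCurves.Rank1Residual
open Summit.BirchSwinnertonDyer.BirchSwinnertonDyer.Theses.CMKolyvaginAtInertTwo (CMSilentHeegnerTwinSupplyAtInertTwo)
open Summit.BirchSwinnertonDyer.BirchSwinnertonDyer.Theorems

/-- PROPOSED one-bit restatement of crux 24648 `CMKolyvaginConjectureAtInertTwo` (text = rev-20 decl + «Σ ≤ 1 →» after Heegner). -/
def CMKolyvaginConjectureAtInertTwoOneBit : Prop :=
  ∀ (W : WeierstrassCurve ℚ) [W.IsElliptic] [W.IsGloballyMinimal] [NeZero (W.conductorNorm ℤ)], W.HasCM → Literature.NumberTheory.EllipticCurves.Rank1Residual.CMInert W 2 → W.HasSurjectiveModNGaloisRep (2 : ℤ) → W.analyticRank = 1 → Odd W.tamagawaProduct → ∀ (K : Type) [Field K] [NumberField K], Literature.NumberTheory.EllipticCurves.IsImaginaryQuadratic K → Odd (NumberField.discr K) → NumberField.discr K ≠ -3 → Literature.NumberTheory.EllipticCurves.SatisfiesHeegnerHypothesis (W.conductorNorm ℤ) K → (∑ q ∈ (NumberField.discr K).natAbs.primeFactors, ((if jacobiSym W.Δ.num q = -1 then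 1 else 0) + (if jacobiSym W.Δ.num q = 1 ∧ Even (W.frobeniusTrace q) then 2 else 0)) ≤ 1) → ∀ (Dt : Literature.NumberTheory.EllipticCurves.ModularForms.ModularParametrizationData W (W.conductorNorm ℤ)), (∀ z ∈ Dt.L.lattice, ∃ w ∈ Literature.NumberTheory.EllipticCurves.ModularForms.periodLattice Dt.f, z = (Dt.c : ℂ) * w) → Odd Dt.c → ∀ (β : ℤ) (ι : K →+* ℂ) (d₁ : Literature.NumberTheory.EllipticCurves.KolyvaginHeegnerData Dt β ι 1), ¬ IsOfFinAddOrder d₁.derivedPoint → ∃ (n : ℕ) (d : Literature.NumberTheory.EllipticCurves.KolyvaginHeegnerData Dt β ι n), Squarefree n ∧ (∀ ℓ ∈ n.primeFactors, (Literature.NumberTheory.EllipticCurves.Zhang2014.IsKolyvaginPrime (W.conductorNorm ℤ) W K 2 ℓ ∧ Literature.NumberTheory.EllipticCurves.Rank1Residual.CMInert W ℓ)) ∧ ¬ ∃ Q : (W.baseChange (Literature.NumberTheory.EllipticCurves.ringClassField K ι n)).toAffine.Point, (2 : ℤ) • Q = d.derivedPoint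

/-- PROPOSED one-bit restatement of R0 28176 `CMHeegnerTwoPrimitiveOfTrivialShaTwo` (same insertion). -/
def CMHeegnerTwoPrimitiveOfTrivialShaTwoOneBit : Prop :=
  ∀ (W : WeierstrassCurve ℚ) [W.IsElliptic] [W.IsGloballyMinimal] [NeZero (W.conductorNorm ℤ)], W.HasCM → Literature.NumberTheory.EllipticCurves.Rank1Residual.CMInert W 2 → W.HasSurjectiveModNGaloisRep (2 : ℤ) → W.analyticRank = 1 → Odd W.tamagawaProduct → ∀ (K : Type) [Field K] [NumberField K], Literature.NumberTheory.EllipticCurves.IsImaginaryQuadratic K → Odd (NumberField.discr K) → NumberField.discr K ≠ -3 → Literature.NumberTheory.EllipticCurves.SatisfiesHeegnerHypothesis (W.conductorNorm ℤ) K → (∑ q ∈ (NumberField.discr K).natAbs.primeFactors, ((if jacobiSym W.Δ.num q = -1 then 1 else 0) + (if jacobiSym W.Δ.num q = 1 ∧ Even (W.frobeniusTrace q) then 2 else 0)) ≤ 1) → ∀ (Dt : Literature.NumberTheory.EllipticCurves.ModularForms.ModularParametrizationData W (W.conductorNorm ℤ)), (∀ z ∈ Dt.L.lattice, ∃ w ∈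 Literature.NumberTheory.EllipticCurves.ModularForms.periodLattice Dt.f, z = (Dt.c : ℂ) * w) → Odd Dt.c → ∀ (β : ℤ) (ι : K →+* ℂ) (d₁ : Literature.NumberTheory.EllipticCurves.KolyvaginHeegnerData Dt β ι 1), ¬ IsOfFinAddOrder d₁.derivedPoint → AddCommGroup.primaryComponent (W.baseChange K).sha 2 = ⊥ → ¬ ∃ Q : (W.baseChange (Literature.NumberTheory.EllipticCurves.ringClassField K ι 1)).toAffine.Point, (2 : ℤ) • Q = d₁.derivedPoint

/-- PROPOSED one-bit restatement of R1 28177 `CMKolyvaginDescentOfNontrivialShaTwo` (same insertion). -/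
def CMKolyvaginDescentOfNontrivialShaTwoOneBit : Prop :=
  ∀ (W : WeierstrassCurve ℚ) [W.IsElliptic] [W.IsGloballyMinimal] [NeZero (W.conductorNorm ℤ)], W.HasCM → Literature.NumberTheory.EllipticCurves.Rank1Residual.CMInert W 2 → W.HasSurjectiveModNGaloisRep (2 : ℤ) → W.analyticRank = 1 → Odd W.tamagawaProduct → ∀ (K : Type) [Field K] [NumberField K], Literature.NumberTheory.EllipticCurves.IsImaginaryQuadratic K → Odd (NumberField.discr K) → NumberField.discr K ≠ -3 → Literature.NumberTheory.EllipticCurves.SatisfiesHeegnerHypothesis (W.conductorNorm ℤ) K → (∑ q ∈ (NumberField.discr K).natAbs.primeFactors, ((if jacobiSym W.Δ.num q = -1 then 1 else 0) + (if jacobiSym W.Δ.num q = 1 ∧ Even (W.frobeniusTrace q) then 2 else 0)) ≤ 1) → ∀ (Dt : Literature.NumberTheory.EllipticCurves.ModularForms.ModularParametrizationData W (W.conductorNorm ℤ)), (∀ z ∈ Dt.L.lattice, ∃ w ∈ Literature.NumberTheory.EllipticCurves.ModularForms.periodLattice Dt.f, z = (Dt.c : ℂ) * w) → Odd Dt.c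 → ∀ (β : ℤ) (ι : K →+* ℂ) (d₁ : Literature.NumberTheory.EllipticCurves.KolyvaginHeegnerData Dt β ι 1), ¬ IsOfFinAddOrder d₁.derivedPoint → AddCommGroup.primaryComponent (W.baseChange K).sha 2 ≠ ⊥ → ∃ (n : ℕ) (d : Literature.NumberTheory.EllipticCurves.KolyvaginHeegnerData Dt β ι n), Squarefree n ∧ (∀ ℓ ∈ n.primeFactors, (Literature.NumberTheory.EllipticCurves.Zhang2014.IsKolyvaginPrime (W.conductorNorm ℤ) W K 2 ℓ ∧ Literature.NumberTheory.EllipticCurves.Rank1Residual.CMInert W ℓ)) ∧ ¬ ∃ Q : (W.baseChange (Literature.NumberTheory.EllipticCurves.ringClassField K ι n)).toAffine.Point, (2 : ℤ) • Q = d.derivedPoint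

/-- PROPOSED glue (replaces 28178 in shape): R0′ → R1′ → KC′. -/
def CMKolyvaginConjectureOfShaRegimesOneBit : Prop :=
  CMHeegnerTwoPrimitiveOfTrivialShaTwoOneBit → CMKolyvaginDescentOfNontrivialShaTwoOneBit → CMKolyvaginConjectureAtInertTwoOneBit

/-- THE GLUE CLOSER (same proof as `CMSupply.cmKolyvaginConjectureOfShaRegimes_proof`: by_cases on `Ш(E_K)(2) = ⊥`). -/
theorem cmKolyvaginConjectureOfShaRegimesOneBit_proof : CMKolyvaginConjectureOfShaRegimesOneBit := by
  intro hR0 hR1 W _ _ _ hCM hin hρ hr hT K _ _ hK hodd h3 hH hdef Dt hDt hc β ι d₁ hy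
  by_cases hsha : AddCommGroup.primaryComponent (W.baseChange K).sha 2 = ⊥
  · refine ⟨1, d₁, squarefree_one, ?_, hR0 W hCM hin hρ hr hT K hK hodd h3 hH hdef Dt hDt hc β ι d₁ hy hsha⟩
    intro ℓ hℓ
    rw [Nat.primeFactors_one] at hℓ
    exact absurd hℓ (Finset.notMem_empty ℓ)
  · exact hR1 W hCM hin hρ hr hT K hK hodd h3 hH hdef Dt hDt hc β ι d₁ hy hsha

/-- The supply derivation 28664 with the ONE-BIT Kolyvagin conjecture as antecedent (text = rev-20 decl of
`CMPrimitiveSupplyAtInertTwoOneBitOfFacts` with `CMKolyvaginConjectureAtInertTwo` ↦ `…OneBit`). -/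
def CMPrimitiveSupplyAtInertTwoOneBitOfFactsOneBitKC : Prop :=
  (Literature.NumberTheory.EllipticCurves.ModularForms.exists_isNewformOf ∧ (∀ (N : ℕ) [NeZero N] (W : WeierstrassCurve ℚ) (K : Type) [Field K] [NumberField K], Literature.NumberTheory.EllipticCurves.gross_zagier N W K)) → CMSilentHeegnerTwinSupplyAtInertTwo → CMKolyvaginConjectureAtInertTwoOneBit → (∀ (W : WeierstrassCurve ℚ) [W.IsElliptic] [W.IsGloballyMinimal] [NeZero (W.conductorNorm ℤ)], W.HasCM → Literature.NumberTheory.EllipticCurves.Rank1Residual.CMInert W 2 → W.HasSurjectiveModNGaloisRep (2 : ℤ) → W.analyticRank = 1 → Odd W.tamagawaProduct → (∃ Dt : Literature.NumberTheory.EllipticCurves.ModularForms.ModularParametrizationData W (W.conductorNorm ℤ), (∀ z ∈ Dt.L.lattice, ∃ w ∈ Literature.NumberTheory.EllipticCurves.ModularForms.periodLattice Dt.f, z = (Dt.c : ℂ) * w) ∧ Odd Dt.c) → ∃ (K : Type) (_ : Field K) (_ : NumberField K), Literature.NumberTheory.EllipticCurves.IsImaginaryQuadratic K ∧ Odd (NumberField.discr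 K) ∧ NumberField.discr K ≠ -3 ∧ Literature.NumberTheory.EllipticCurves.SatisfiesHeegnerHypothesis (W.conductorNorm ℤ) K ∧ (∑ q ∈ (NumberField.discr K).natAbs.primeFactors, ((if jacobiSym W.Δ.num q = -1 then 1 else 0) + (if jacobiSym W.Δ.num q = 1 ∧ Even (W.frobeniusTrace q) then 2 else 0)) ≤ 1) ∧ ¬ IsSquare ((NumberField.discr K : ℚ) * -|W.Δ|) ∧ ¬ IsSquare ((NumberField.discr K : ℚ) * (-(2 * |W.Δ|))) ∧ ∃ (Dt : Literature.NumberTheory.EllipticCurves.ModularForms.ModularParametrizationData W (W.conductorNorm ℤ)) (β : ℤ) (ι : K →+* ℂ) (d₁ : Literature.NumberTheory.EllipticCurves.KolyvaginHeegnerData Dt β ι 1), (∀ z ∈ Dt.L.lattice, ∃ w ∈ Literature.NumberTheory.EllipticCurves.ModularForms.periodLattice Dt.f, z = (Dt.c : ℂ) * w) ∧ Odd Dt.c ∧ ¬ IsOfFinAddOrder d₁.derivedPoint ∧ ∃ M₀ : ℕ, (∃ Q : (W.baseChange (Literature.NumberTheory.EllipticCurves.ringClassField K ι 1)).toAffine.Point,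 ((2 ^ M₀ : ℕ) : ℤ) • Q = d₁.derivedPoint) ∧ (¬ ∃ Q : (W.baseChange (Literature.NumberTheory.EllipticCurves.ringClassField K ι 1)).toAffine.Point, ((2 ^ (M₀ + 1) : ℕ) : ℤ) • Q = d₁.derivedPoint) ∧ ∃ (n : ℕ) (d : Literature.NumberTheory.EllipticCurves.KolyvaginHeegnerData Dt β ι n), Squarefree n ∧ (∀ ℓ ∈ n.primeFactors, (Literature.NumberTheory.EllipticCurves.Zhang2014.IsKolyvaginPrime (W.conductorNorm ℤ) W K 2 ℓ ∧ Literature.NumberTheory.EllipticCurves.Rank1Residual.CMInert W ℓ)) ∧ (¬ ∃ Q : (W.baseChange (Literature.NumberTheory.EllipticCurves.ringClassField K ι n)).toAffine.Point, (2 : ℤ) • Q = d.derivedPoint) ∧ ∃ (Wd : WeierstrassCurve ℚ) (_ : Wd.IsElliptic) (_ : Wd.IsGloballyMinimal), (∃ C : WeierstrassCurve.VariableChange ℚ, C • W.quadraticTwist (NumberField.discr K : ℚ) = Wd) ∧ Wd.HasCM ∧ Wd.analyticRank = 0)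

/-- THE SUPPLY CLOSER re-certified: p762930's proof VERBATIM except that `hdef` (from HL′) is passed to the one-bit KC. -/
theorem cmPrimitiveSupplyAtInertTwoOneBitOfFactsOneBitKC_proof : CMPrimitiveSupplyAtInertTwoOneBitOfFactsOneBitKC := by
  rintro ⟨hmod, hGZ⟩ hHS hKoly W _ _ _ hCM hin hρ hr hT ⟨Dt, hDt, hc⟩
  obtain ⟨K, _, _, hK, hodd, h3, hH, hdef, hL⟩ := hHS W hCM hin hρ hr
  obtain ⟨hsq1, hsq2⟩ :=
    KolyvaginFrobeniusTwo.not_isSquare_and_of_cmInert_two_of_heegner W hCM hin hρ K hK hodd hH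
  obtain ⟨β, hβ⟩ := exists_dvd_sq_sub_discr_holds (W.conductorNorm ℤ) K hK hH
  let ι : K →+* ℂ := Classical.choice inferInstance
  obtain ⟨d₁⟩ := exists_kolyvaginHeegnerData_one
    (phi_heegnerTau_mem_singularModuliField_holds (W.conductorNorm ℤ) W K) hK Dt β ι hβ
  have hy₁ : ¬ IsOfFinAddOrder d₁.derivedPoint :=
    CMSupply.not_isOfFinAddOrder_derivedPoint_one_of_rankOne hmod W K (hGZ _ W K) hK hH hr hL d₁
  haveI : NumberField (ringClassField K ι 1) := numberField_ringClassField hK ι one_ne_zero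
  haveI : (W.baseChange (ringClassField K ι 1)).IsElliptic := by rw [baseChange]; infer_instance
  haveI : Module.Finite ℤ (W.baseChange (ringClassField K ι 1)).toAffine.Point := by
    convert (W.baseChange (ringClassField K ι 1)).module_finite_point_holds
  obtain ⟨M₀, hdiv, hndiv⟩ := exists_pow_smul_eq_and_not_of_not_isOfFinAddOrder Nat.prime_two hy₁
  obtain ⟨n, d, hn, hKol, hprim⟩ := hKoly W hCM hin hρ hr hT K hK hodd h3 hH hdef Dt hDt hc β ι d₁ hy₁
  obtain ⟨Wd, _, _, hWd, hcmd, hrd⟩ := CMSupply.exists_minimal_twin_hasCM_analyticRank_zero hmod W hCM K hL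
  exact ⟨K, _, _, hK, hodd, h3, hH, hdef, hsq1, hsq2, Dt, β, ι, d₁, hDt, hc, hy₁, M₀, hdiv, hndiv,
    n, d, hn, hKol, hprim, Wd, ‹_›, ‹_›, hWd, hcmd, hrd⟩

/-- Sanity: the ∀K conjecture 24648 implies its one-bit restriction (so nothing already landed against 24648 is lost). -/
theorem oneBit_of_all (h : Summit.BirchSwinnertonDyer.BirchSwinnertonDyer.Theses.CMKolyvaginAtInertTwo.CMKolyvaginConjectureAtInertTwo) :
    CMKolyvaginConjectureAtInertTwoOneBit := by
  intro W _ _ _ hCM hin hρ hr hT K _ _ hK hodd h3 hH _ Dt hDt hc β ι d₁ hy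
  exact h W hCM hin hρ hr hT K hK hodd h3 hH Dt hDt hc β ι d₁ hy

end Scratch.CMKolyvaginConjectureOneBit

end
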